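import Summits.ABC.ABC.Theorems.TwistAmplificationMazurKaneLawDERoots
import Literature.NumberTheory.DiophantineGeometry.AbcShapeSubBox
import Literature.NumberTheory.DiophantineGeometry.AbcShapeGeometrySets

-- Summit.ABC.ABC is the mandated summit-side namespace (single-conjunct summit); the lakefile sets the same option tree-wide.
set_option linter.dupNamespace false

/-!
# Square congruences in product variables covered by integer root lattices
(crux stmt-ABC-2757, DE tool, stub `de_productVars_card_le_sum_coprime`)

A counting fact for the line `critical-kloosterman-powerful-moduli` of the crux
`Summit.ABC.ABC.Theses.TwistAmplification.MazurKaneLaw` (the "DE tool"). The multiplicative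
energy of the DE tool, written in product variables, is the number `#G₀` of pairs
`((A, Cp), (B, Dp))` with `A, B ∈ [1, S]` (`S = 4 Y_{i₁} Z_{i₁}`), `Cp, Dp` in the product of
the two sub-boxes, `gcd(q, B) = gcd(q, F(Cp)) = gcd(q, F(Dp)) = 1` and
`q ∣ A² F(Cp) - B² F(Dp)`, where `F(Cp) = c₂ · offVal Cp.1 · (c₃ · offVal Cp.2)`.

* `de_productVars_card_le_sum_coprime`: `#G₀` is at most the sum, over the pairs `cd = (Cp, Dp)`
  with `F(Cp)` and `F(Dp)` prime to `q` and over the integer lifts `l ∈ [0, q)` of the roots of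
  `l² F(Cp) ≡ F(Dp) (mod q)`, of the number of points of the root lattice
  `{(A, B) ∈ [1, S]² : q ∣ A - l B}` (integer box).

The proof fibres `G₀` over `cd` (`Finset.card_eq_sum_card_fiberwise`) and injects each fibre, via
`(A, B) ↦ ((A : ℤ), (B : ℤ))`, into the union of the root lattices: the class `λ = A · B⁻¹ ∈ ZMod q`
is a root (`de_rootClass_of_sqCongr`) and `l := λ.val` is its integer lift. The bookkeeping is
done once for an arbitrary finite index set `CP` and weight `F` (`de_pv_card_le_sum_general`).
No new definitions; everything here is folklore.
-/

namespace Summit.ABC.ABC.Theorems.MazurKaneLaw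

open Finset
open Literature.NumberTheory.DiophantineGeometry
open Literature.NumberTheory.DiophantineGeometry.AbcShapes

/-- For naturals `m, n, q`: `q ∣ m - n` in `ℤ` iff `m = n` in `ZMod q`. [folklore] -/
theorem de_pv_dvd_sub_iff (q m n : ℕ) :
    (q : ℤ) ∣ ((m : ℕ) : ℤ) - ((n : ℕ) : ℤ) ↔ (m : ZMod q) = (n : ZMod q) := by
  rw [ZMod.natCast_eq_natCast_iff, Nat.modEq_iff_dvd]
  exact dvd_sub_comm

/-- For `a, b ∈ ℤ` and `l, q ∈ ℕ`: `q ∣ a - l b` in `ℤ` iff `a = l b` in `ZMod q`. [folklore] -/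
theorem de_pv_dvd_sub_mul_iff (q l : ℕ) (a b : ℤ) :
    (q : ℤ) ∣ a - (l : ℤ) * b ↔ (a : ZMod q) = (l : ZMod q) * (b : ZMod q) := by
  rw [← ZMod.intCast_eq_intCast_iff_dvd_sub, Int.cast_mul, Int.cast_natCast, eq_comm]

/-- **Square congruences in product variables, general index set.**  Let `q ≥ 1`, `S ∈ ℕ`,
`T ∈ ℤ` with `S ≤ T`, `CP` a finite set and `F : CP → ℕ`. The pairs `((A, c), (B, e))` with
`A, B ∈ [1, S]`, `c, e ∈ CP`, `gcd(q, B) = gcd(q, F c) = gcd(q, F e) = 1` and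
`q ∣ A² F(c) - B² F(e)` number at most
`∑_{(c, e) : gcd(q, F c) = gcd(q, F e) = 1} ∑_{l < q : q ∣ l² F(c) - F(e)} N(l)` with
`N(l) := #{(A, B) ∈ [1, T]² : q ∣ A - l B}`: fibre over `(c, e)` and send `(A, B)` to the
lattice of the integer lift `l` of the root `A · B⁻¹ ∈ ZMod q`. [folklore] -/
theorem de_pv_card_le_sum_general {α : Type*} (CP : Finset α) (F : α → ℕ) {q : ℕ}
    (hq : 0 < q) (S : ℕ) {T : ℤ} (hT : (S : ℤ) ≤ T) :
    (((Icc 1 S ×ˢ CP) ×ˢ (Icc 1 S ×ˢ CP)).filter (fun g : (ℕ × α) × (ℕ × α) =>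
        Nat.Coprime q g.2.1 ∧ Nat.Coprime q (F g.1.2) ∧ Nat.Coprime q (F g.2.2) ∧
          (q : ℤ) ∣ ((g.1.1 ^ 2 * F g.1.2 : ℕ) : ℤ) - ((g.2.1 ^ 2 * F g.2.2 : ℕ) : ℤ))).card ≤
      ∑ cd ∈ (CP ×ˢ CP).filter
          (fun cd : α × α => Nat.Coprime q (F cd.1) ∧ Nat.Coprime q (F cd.2)),
        ∑ l ∈ (range q).filter
            (fun l : ℕ => (q : ℤ) ∣ ((l ^ 2 * F cd.1 : ℕ) : ℤ) - ((F cd.2 : ℕ) : ℤ)),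
          ((Icc (1 : ℤ) T ×ˢ Icc (1 : ℤ) T).filter
              (fun p : ℤ × ℤ => (q : ℤ) ∣ p.1 - (l : ℤ) * p.2)).card := by
  classical
  haveI : NeZero q := ⟨by omega⟩
  refine (Finset.card_eq_sum_card_fiberwise
    (f := fun g : (ℕ × α) × (ℕ × α) => (g.1.2, g.2.2)) ?_).trans_le
    (Finset.sum_le_sum fun cd _ => ?_)
  · -- every element of `G₀` has its pair `(c, e)` in the coprime part of `CP × CP`
    intro g hg
    obtain ⟨hbox, -, hC, hD, -⟩ := Finset.mem_filter.mp (Finset.mem_coe.mp hg)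
    obtain ⟨h1, h2⟩ := Finset.mem_product.mp hbox
    exact Finset.mem_coe.mpr (Finset.mem_filter.mpr
      ⟨Finset.mem_product.mpr ⟨(Finset.mem_product.mp h1).2, (Finset.mem_product.mp h2).2⟩,
        hC, hD⟩)
  · -- the fibre over `cd` injects into the union of the root lattices
    refine le_trans (Finset.card_le_card_of_injOn
      (fun g : (ℕ × α) × (ℕ × α) => ((g.1.1 : ℤ), (g.2.1 : ℤ))) ?_ ?_) Finset.card_biUnion_le
    · intro g hg
      obtain ⟨hG, hgcd⟩ := Finset.mem_filter.mp (Finset.mem_coe.mp hg)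
      obtain ⟨hbox, hcopB, -, -, hdvd⟩ := Finset.mem_filter.mp hG
      subst hgcd
      have hb : (g.2.1 : ZMod q) * (g.2.1 : ZMod q)⁻¹ = 1 :=
        ZMod.coe_mul_inv_eq_one g.2.1 hcopB.symm
      have heq : (g.1.1 : ZMod q) ^ 2 * (F g.1.2 : ZMod q) =
          (g.2.1 : ZMod q) ^ 2 * (F g.2.2 : ZMod q) := by
        have h := (de_pv_dvd_sub_iff q _ _).mp hdvd
        simpa only [Nat.cast_mul, Nat.cast_pow] using h
      obtain ⟨hroot, hlat⟩ := de_rootClass_of_sqCongr hb heq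
      have hrootl : (q : ℤ) ∣
          ((((g.1.1 : ZMod q) * (g.2.1 : ZMod q)⁻¹).val ^ 2 * F g.1.2 : ℕ) : ℤ) -
            ((F g.2.2 : ℕ) : ℤ) := by
        rw [de_pv_dvd_sub_iff, Nat.cast_mul, Nat.cast_pow, ZMod.natCast_zmod_val]
        exact hroot
      have hlatl : (q : ℤ) ∣
          (g.1.1 : ℤ) - ((((g.1.1 : ZMod q) * (g.2.1 : ZMod q)⁻¹).val : ℕ) : ℤ) * (g.2.1 : ℤ) := by
        rw [de_pv_dvd_sub_mul_iff, Int.cast_natCast, Int.cast_natCast, ZMod.natCast_zmod_val]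
        exact hlat
      have hboxZ : ((g.1.1 : ℤ), (g.2.1 : ℤ)) ∈ Icc (1 : ℤ) T ×ˢ Icc (1 : ℤ) T := by
        obtain ⟨h1, h2⟩ := Finset.mem_product.mp hbox
        have hA := Finset.mem_Icc.mp (Finset.mem_product.mp h1).1
        have hB := Finset.mem_Icc.mp (Finset.mem_product.mp h2).1
        simp only [Finset.mem_product, Finset.mem_Icc]
        exact ⟨⟨by omega, by omega⟩, ⟨by omega, by omega⟩⟩
      rw [Finset.mem_coe, Finset.mem_biUnion]
      exact ⟨((g.1.1 : ZMod q) * (g.2.1 : ZMod q)⁻¹).val,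
        Finset.mem_filter.mpr ⟨Finset.mem_range.mpr (ZMod.val_lt _), hrootl⟩,
        Finset.mem_filter.mpr ⟨hboxZ, hlatl⟩⟩
    · intro g hg g' hg' h
      have h' : ((g.1.1 : ℤ), (g.2.1 : ℤ)) = ((g'.1.1 : ℤ), (g'.2.1 : ℤ)) := h
      obtain ⟨h1, h2⟩ := Prod.mk.inj h'
      have hc : (g.1.2, g.2.2) = cd := (Finset.mem_filter.mp (Finset.mem_coe.mp hg)).2
      have hc' : (g'.1.2, g'.2.2) = cd := (Finset.mem_filter.mp (Finset.mem_coe.mp hg')).2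
      obtain ⟨h3, h4⟩ := Prod.mk.inj (hc.trans hc'.symm)
      exact Prod.ext (Prod.ext (by exact_mod_cast h1) h3) (Prod.ext (by exact_mod_cast h2) h4)

/-- **Square congruences in product variables ⇒ sum of root-lattice counts (integer lifts).**
For `q ≥ 1`, with `CP := subBox {i₀, i₁} Y × subBox {i₀, i₁} Z`,
`F(Cp) := c₂ · offVal {i₀, i₁} Cp.1 · (c₃ · offVal {i₀, i₁} Cp.2)` and `S := 4 Y_{i₁} Z_{i₁}`, the
set `G₀` of pairs `((A, Cp), (B, Dp)) ∈ ([1, S] × CP)²` with `gcd(q, B) = gcd(q, F(Cp)) =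
gcd(q, F(Dp)) = 1` and `q ∣ A² F(Cp) - B² F(Dp)` satisfies
`#G₀ ≤ ∑_{(Cp, Dp) ∈ CP², F(Cp), F(Dp) prime to q} ∑_{l < q, q ∣ l² F(Cp) - F(Dp)}
#{(A, B) ∈ [1, S]² ⊆ ℤ² : q ∣ A - l B}`. [folklore] -/
theorem de_productVars_card_le_sum_coprime : ∀ {d : ℕ} (i₀ i₁ : Fin d) (q c₂ c₃ : ℕ), 0 < q → ∀ (Y Z : Fin d → ℕ), ((((Finset.Icc 1 (4 * (Y i₁ * Z i₁)) ×ˢ (subBox ({i₀, i₁} : Finset (Fin d)) Y ×ˢ subBox ({i₀, i₁} : Finset (Fin d)) Z)) ×ˢ (Finset.Icc 1 (4 * (Y i₁ * Z i₁)) ×ˢ (subBox ({i₀, i₁} : Finset (Fin d)) Y ×ˢ subBox ({i₀, i₁} : Finset (Fin d)) Z))).filter (fun g : (ℕ × ((Fin d → ℕ) × (Fin d → ℕ))) × (ℕ × ((Fin d → ℕ) × (Fin d → ℕ))) => Nat.Coprime q g.2.1 ∧ Nat.Coprime q (c₂ * offVal ({i₀, i₁} : Finset (Fin d)) g.1.2.1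 * (c₃ * offVal ({i₀, i₁} : Finset (Fin d)) g.1.2.2)) ∧ Nat.Coprime q (c₂ * offVal ({i₀, i₁} : Finset (Fin d)) g.2.2.1 * (c₃ * offVal ({i₀, i₁} : Finset (Fin d)) g.2.2.2)) ∧ (q : ℤ) ∣ ((g.1.1 ^ 2 * (c₂ * offVal ({i₀, i₁} : Finset (Fin d)) g.1.2.1 * (c₃ * offVal ({i₀, i₁} : Finset (Fin d)) g.1.2.2)) : ℕ) : ℤ) - ((g.2.1 ^ 2 * (c₂ * offVal ({i₀, i₁} : Finset (Fin d)) g.2.2.1 * (c₃ * offVal ({i₀, i₁} : Finset (Fin d)) g.2.2.2)) : ℕ) : ℤ)))).card ≤ ∑ cd ∈ ((subBox ({i₀, i₁} : Finset (Fin d)) Y ×ˢ subBox ({i₀, i₁} : Finset (Fin d)) Z) ×ˢ (subBox ({i₀, i₁} : Finset (Fin d)) Y ×ˢ subBox ({i₀, i₁} : Finset (Fin d)) Z)).filter (fun cd : ((Fin d → ℕ) × (Fin d → ℕ)) × ((Fin d → ℕ) × (Fin d → ℕ)) => Nat.Coprime q (c₂ * offVal ({i₀, i₁} : Finset (Fin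 d)) cd.1.1 * (c₃ * offVal ({i₀, i₁} : Finset (Fin d)) cd.1.2)) ∧ Nat.Coprime q (c₂ * offVal ({i₀, i₁} : Finset (Fin d)) cd.2.1 * (c₃ * offVal ({i₀, i₁} : Finset (Fin d)) cd.2.2))), ∑ l ∈ ((Finset.range q).filter (fun l : ℕ => (q : ℤ) ∣ ((l ^ 2 * (c₂ * offVal ({i₀, i₁} : Finset (Fin d)) cd.1.1 * (c₃ * offVal ({i₀, i₁} : Finset (Fin d)) cd.1.2)) : ℕ) : ℤ) - (((c₂ * offVal ({i₀, i₁} : Finset (Fin d)) cd.2.1 * (c₃ * offVal ({i₀, i₁} : Finset (Fin d)) cd.2.2)) : ℕ) : ℤ))), ((Finset.Icc (1 : ℤ) (4 * (Y i₁ * Z i₁)) ×ˢ Finset.Icc (1 : ℤ) (4 * (Y i₁ * Z i₁))).filter (fun p : ℤ × ℤ => (q : ℤ) ∣ p.1 - (l : ℤ) * p.2)).card := by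
  intro d i₀ i₁ q c₂ c₃ hq Y Z
  exact de_pv_card_le_sum_general
    (subBox ({i₀, i₁} : Finset (Fin d)) Y ×ˢ subBox ({i₀, i₁} : Finset (Fin d)) Z)
    (fun Cp : (Fin d → ℕ) × (Fin d → ℕ) =>
      c₂ * offVal ({i₀, i₁} : Finset (Fin d)) Cp.1 * (c₃ * offVal ({i₀, i₁} : Finset (Fin d)) Cp.2))
    hq (4 * (Y i₁ * Z i₁)) (by exact_mod_cast le_refl (4 * (Y i₁ * Z i₁)))

end Summit.ABC.ABC.Theorems.MazurKaneLaw
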